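import Summits.QuantumFields.YangMills.Theorems.UnitScaleTiltSmoothLiftLoopWalk
import HarnessLib

/-!
# Route `UnitScaleTilt`, crux K1 child «MinimiserStabilityRegPr» (stmt-QuantumFields-19200), stub `stub_smoothLift` (G-K1a-2′) — helper P3b:
# THE LOOP VARIABLES OF (0.4) OF THE SMOOTH INTERPOLATION AS ONE PRODUCT OF EXPONENTIALS

Fleet seat `ym-ust-19200-p2` (gen 0).  For `W = interp V` (`UnitScaleTiltSmoothLiftInterpDefs`) and a coarse bond `c = ⟨y, y + e_μ⟩`, the
loop word `Γ^σ ∪ [x,x′] ∪ (−Γ^{σ′}) ∪ (−c)` of [Balaban1987RG1] (0.4) at the offset `n` splits at the two crossings of the face between `B(y)`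
and `B(y + e_μ)`:  `Γ^σ` · `(h − n_μ)` steps `+e_μ` · THE FACE BOND · `(n_μ + h)` steps `+e_μ` · `(Γ^{σ′})⁻¹` · `h` steps `−e_μ` · THE CENTRAL
BOND BACKWARDS · `h` steps `−e_μ` (`L = 2h + 1`).  Inside the blocks the transport is a product of exponentials of the model potential
(`UnitScaleTiltSmoothLiftLoopWalk.coe_holAt_walk_siteAt`); the face bond carries `exp((L+1)·potAt F n μ)·V(c)` and the central bond
carries `V(c)` exactly (the potential vanishes on the axis), so the two copies of `V(c)` CONJUGATE the part of the loop in `B(y + e_μ)`: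
**`coe_loopHol_interp`** — `U(loop) = Π_k exp X_k` for an explicit list of exponents built from `stepExps` of the curvature tensors
`F = curv V y` and `F″ = V(c)·curv V (y+e_μ)·V(c)*`.  §1: positions and the box conditions of the six segments; §2: the product.
[cite: Balaban1987RG1, (0.3)-(0.4) p.252; King1986, (A.5) p.676]
-/

noncomputable section

open scoped Matrix.Norms.L2Operator BigOperators

namespace Summit.QuantumFields.YangMills.Theorems.SmoothLiftInterp

open Literature.MathematicalPhysics.QuantumFieldTheory.Balaban1983to89
open MatrixLog T4Continuum AveragingRT BlockAveraging BlockAveragingSection BlockAveragingSectionPlaq NormedSpace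

variable {P : Params} {j : ℕ}

/-! ## §1 Positions along the loop word and the box conditions of its segments -/

section Positions

/-- The centre of the neighbouring block: `siteAt (y + e_μ) e = siteAt y (e + L e_μ)`. [cite: Balaban1987RG1, (0.3) p.252] -/
theorem siteAt_blockShift (y : Site P (j+1)) (μ : Fin P.d) (e : Fin P.d → ℤ) :
    siteAt (y.shift μ) e = siteAt y (e + Pi.single μ (P.L : ℤ)) := by
  funext ν
  rw [siteAt_apply, siteAt_apply, emb_shift_apply, Pi.add_apply, Pi.single_apply]
  by_cases h : ν = μ
  · subst h; simp only [if_true]; push_cast; ring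
  · simp [h]

/-- Walking a word from `siteAt y e` ends at `siteAt y (e + netDisp w)`. [folklore] -/
theorem walkEnd_siteAt (y : Site P (j+1)) (e : Fin P.d → ℤ) (w : List (Letter P.d)) :
    walkEnd (siteAt y e) w = siteAt y (e + fun ν => netDisp w ν) := by
  funext ν
  rw [walkEnd_apply, siteAt_apply, siteAt_apply, Pi.add_apply]
  push_cast; ring

/-- The centre is the offset `0`. [folklore] -/
theorem emb_eq_siteAt_zero (y : Site P (j+1)) : emb y = siteAt y (0 : Fin P.d → ℤ) := (siteAt_zero y).symm

/-- Box condition of a staircase from the centre: its prefixes lie between `0` and `n`. [cite: Balaban1987RG1, (0.3) p.252] -/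
theorem box_stairWord (σ : Equiv.Perm (Fin P.d)) (r : Fin P.d → Fin P.L) (k : ℕ) (ν : Fin P.d) :
    -(((P.L - 1) / 2 : ℕ) : ℤ) ≤ (0 : Fin P.d → ℤ) ν + netDisp ((stairWord σ (off r)).take k) ν ∧
      (0 : Fin P.d → ℤ) ν + netDisp ((stairWord σ (off r)).take k) ν ≤ (((P.L - 1) / 2 : ℕ) : ℤ) := by
  have h1 := netDisp_take_stairWord σ (off r) ν k
  have h2 := off_bounds r ν
  simp only [Pi.zero_apply, zero_add]
  constructor
  · exact le_trans (by have := h2.1; have := min_le_right (0:ℤ) (off r ν); omega) h1.1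
  · exact le_trans h1.2 (by have := h2.2; exact max_le (by positivity) this)

/-- Box condition of a reversed staircase from its endpoint `n`: its prefixes are prefixes of the staircase. [cite: Balaban1987RG1, (0.3) p.252] -/
theorem box_wordRev_stairWord (σ : Equiv.Perm (Fin P.d)) (r : Fin P.d → Fin P.L) (k : ℕ) (ν : Fin P.d) :
    -(((P.L - 1) / 2 : ℕ) : ℤ) ≤ off r ν + netDisp ((wordRev (stairWord σ (off r))).take k) ν ∧
      off r ν + netDisp ((wordRev (stairWord σ (off r))).take k) ν ≤ (((P.L - 1) / 2 : ℕ) : ℤ) := by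
  obtain ⟨m, hm⟩ := netDisp_take_wordRev (stairWord σ (off r)) k
  rw [hm ν, netDisp_stairWord]
  have h := box_stairWord σ r m ν
  simp only [Pi.zero_apply, zero_add] at h
  constructor <;> omega

/-- Box condition of a forward axis run of `t` steps from `e` with `e_μ + t ≤ (L−1)/2`. [folklore] -/
theorem box_replicate_true {e : Fin P.d → ℤ} (he : ∀ ν, -(((P.L - 1) / 2 : ℕ) : ℤ) ≤ e ν ∧ e ν ≤ (((P.L - 1) / 2 : ℕ) : ℤ))
    (μ : Fin P.d) {t : ℕ} (ht : e μ + t ≤ (((P.L - 1) / 2 : ℕ) : ℤ)) (k : ℕ) (ν : Fin P.d) :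
    -(((P.L - 1) / 2 : ℕ) : ℤ) ≤ e ν + netDisp ((List.replicate t ((μ, true) : Letter P.d)).take k) ν ∧
      e ν + netDisp ((List.replicate t ((μ, true) : Letter P.d)).take k) ν ≤ (((P.L - 1) / 2 : ℕ) : ℤ) := by
  rw [netDisp_take_replicate]
  have := he ν
  by_cases h : μ = ν
  · subst h; simp only [if_true, mul_one]; constructor <;> [omega; (have := min_le_right k t; omega)]
  · simp only [if_neg h, mul_zero, add_zero]; exact this

/-- Box condition of a backward axis run of `t` steps from `e` with `−(L−1)/2 ≤ e_μ − t`. [folklore] -/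
theorem box_replicate_false {e : Fin P.d → ℤ} (he : ∀ ν, -(((P.L - 1) / 2 : ℕ) : ℤ) ≤ e ν ∧ e ν ≤ (((P.L - 1) / 2 : ℕ) : ℤ))
    (μ : Fin P.d) {t : ℕ} (ht : -(((P.L - 1) / 2 : ℕ) : ℤ) ≤ e μ - t) (k : ℕ) (ν : Fin P.d) :
    -(((P.L - 1) / 2 : ℕ) : ℤ) ≤ e ν + netDisp ((List.replicate t ((μ, false) : Letter P.d)).take k) ν ∧
      e ν + netDisp ((List.replicate t ((μ, false) : Letter P.d)).take k) ν ≤ (((P.L - 1) / 2 : ℕ) : ℤ) := by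
  rw [netDisp_take_replicate]
  have := he ν
  by_cases h : μ = ν
  · subst h; simp only [if_true, Bool.false_eq_true, if_false, mul_neg, mul_one]
    constructor <;> [(have := min_le_right k t; omega); omega]
  · simp only [if_neg h, mul_zero, add_zero]; exact this

end Positions

/-! ## §2 The segments of the loop -/

section Segments

variable (hj : j + 1 ≤ P.m + P.K) (V : GaugeField P (j+1) (Matrix.specialUnitaryGroup (Fin 2) ℂ)) (y : Site P (j+1)) (μ : Fin P.d)
include hj

/-- **THE FACE BOND OF THE LOOP**: at an offset `f` of the cube with `f_μ = (L−1)/2` the interpolation is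
`exp((L+1)·potAt F f μ) · V(y, y+e_μ)`. [cite: King1986, (A.5) p.676] -/
theorem coe_interp_face {f : Fin P.d → ℤ} (hf : ∀ ν, -(((P.L - 1) / 2 : ℕ) : ℤ) ≤ f ν ∧ f ν ≤ (((P.L - 1) / 2 : ℕ) : ℤ))
    (hfμ : f μ = (((P.L - 1) / 2 : ℕ) : ℤ)) :
    ((interp V ⟨siteAt y f, μ⟩ : Matrix.specialUnitaryGroup (Fin 2) ℂ) : Matrix (Fin 2) (Fin 2) ℂ) =
      exp (((P.L : ℝ) + 1) • potAt P (curv V y) f μ) *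
        ((V ⟨y, μ⟩ : Matrix.specialUnitaryGroup (Fin 2) ℂ) : Matrix (Fin 2) (Fin 2) ℂ) := by
  have hex : ExitsBlock (⟨siteAt y f, μ⟩ : PBond P j) := (exitsBlock_siteAt_iff hj y f hf μ).mpr hfμ
  rw [coe_interp_of_exits V hex]
  simp only [pot_siteAt hj V y f hf, blockOf_siteAt hj y f hf]

/-- **THE CENTRAL BOND CARRIES `V(c)` EXACTLY**: on the axis the model potential vanishes. [cite: King1986, (A.5) p.676] -/
theorem coe_interp_central :
    ((interp V ⟨siteAt y (Function.update (0 : Fin P.d → ℤ) μ (((P.L - 1) / 2 : ℕ) : ℤ)), μ⟩ : Matrix.specialUnitaryGroup (Fin 2) ℂ) :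
        Matrix (Fin 2) (Fin 2) ℂ) = ((V ⟨y, μ⟩ : Matrix.specialUnitaryGroup (Fin 2) ℂ) : Matrix (Fin 2) (Fin 2) ℂ) := by
  have hf : ∀ ν, -(((P.L - 1) / 2 : ℕ) : ℤ) ≤ Function.update (0 : Fin P.d → ℤ) μ (((P.L - 1) / 2 : ℕ) : ℤ) ν ∧
      Function.update (0 : Fin P.d → ℤ) μ (((P.L - 1) / 2 : ℕ) : ℤ) ν ≤ (((P.L - 1) / 2 : ℕ) : ℤ) := by
    intro ν
    by_cases h : ν = μ
    · subst h; rw [Function.update_self]; omega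
    · rw [Function.update_of_ne h, Pi.zero_apply]; omega
  rw [coe_interp_face hj V y μ hf (Function.update_self _ _ _),
    potAt_axis P (curv V y) (curv_self V y μ) (fun ρ hρ => by rw [Function.update_of_ne hρ]; rfl), smul_zero, exp_zero, one_mul]

end Segments

/-! ## §3 The loop variable as one product of exponentials -/

section Product

/-- Splitting a run: `replicate (a + 1 + b) l = replicate a l ++ l :: replicate b l`. [folklore] -/
theorem replicate_split {α : Type*} (a b : ℕ) (l : α) :
    List.replicate (a + 1 + b) l = List.replicate a l ++ (l :: List.replicate b l) := by
  rw [List.replicate_add, List.replicate_succ', List.append_assoc, List.singleton_append]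

/-- **THE LOOP VARIABLE `U(Γ^σ ∪ [x,x′] ∪ (−Γ^{σ′}) ∪ (−c))` OF THE INTERPOLATION IS A PRODUCT OF EXPONENTIALS.**  With `h = (L−1)/2`,
`n` the offset, `F = curv V y`, `F″ = V(c)·curv V (y+e_μ)·V(c)*`, `f = n[n_μ ↦ h]`, `g = n[n_μ ↦ −h]`:
`U(loop) = Πexp( stepExps F 0 Γ^σ ++ stepExps F n (e_μ^{h−n_μ}) ++ [(L+1)·potAt F f μ] ++ stepExps F″ g (e_μ^{n_μ+h})
  ++ stepExps F″ n (Γ^{σ′})⁻¹ ++ stepExps F″ 0 ((−e_μ)^h) ++ stepExps F n[↦h]… )` — the two copies of `V(c)` (face bond, central bond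
backwards) conjugate the three segments in `B(y + e_μ)`. [cite: Balaban1987RG1, (0.4) p.253] -/
theorem coe_loopHol_interp (hj : j + 1 ≤ P.m + P.K) (V : GaugeField P (j+1) (Matrix.specialUnitaryGroup (Fin 2) ℂ))
    (y : Site P (j+1)) (μ : Fin P.d) (r : Fin P.d → Fin P.L) (σ σ' : Equiv.Perm (Fin P.d)) :
    ((loopHol (interp V) ⟨y, μ⟩ (r, σ, σ') : Matrix.specialUnitaryGroup (Fin 2) ℂ) : Matrix (Fin 2) (Fin 2) ℂ) =
      ((stepExps P (curv V y) 0 (stairWord σ (off r)) ++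
        (stepExps P (curv V y) (off r) (List.replicate ((((P.L - 1) / 2 : ℕ) : ℤ) - off r μ).toNat (μ, true)) ++
        ([((P.L : ℝ) + 1) • potAt P (curv V y) (Function.update (off r) μ (((P.L - 1) / 2 : ℕ) : ℤ)) μ] ++
        (stepExps P (fun ρ ν => ((V ⟨y, μ⟩ : Matrix.specialUnitaryGroup (Fin 2) ℂ) : Matrix (Fin 2) (Fin 2) ℂ) * curv V (y.shift μ) ρ ν *
            star ((V ⟨y, μ⟩ : Matrix.specialUnitaryGroup (Fin 2) ℂ) : Matrix (Fin 2) (Fin 2) ℂ))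
            (Function.update (off r) μ (-(((P.L - 1) / 2 : ℕ) : ℤ))) (List.replicate (off r μ + (((P.L - 1) / 2 : ℕ) : ℤ)).toNat (μ, true)) ++
        (stepExps P (fun ρ ν => ((V ⟨y, μ⟩ : Matrix.specialUnitaryGroup (Fin 2) ℂ) : Matrix (Fin 2) (Fin 2) ℂ) * curv V (y.shift μ) ρ ν *
            star ((V ⟨y, μ⟩ : Matrix.specialUnitaryGroup (Fin 2) ℂ) : Matrix (Fin 2) (Fin 2) ℂ))
            (off r) (wordRev (stairWord σ' (off r))) ++
        (stepExps P (fun ρ ν => ((V ⟨y, μ⟩ : Matrix.specialUnitaryGroup (Fin 2) ℂ) : Matrix (Fin 2) (Fin 2) ℂ) * curv V (y.shift μ) ρ ν *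
            star ((V ⟨y, μ⟩ : Matrix.specialUnitaryGroup (Fin 2) ℂ) : Matrix (Fin 2) (Fin 2) ℂ))
            0 (List.replicate ((P.L - 1) / 2) (μ, false)) ++
        stepExps P (curv V y) (Function.update (0 : Fin P.d → ℤ) μ (((P.L - 1) / 2 : ℕ) : ℤ)) (List.replicate ((P.L - 1) / 2) (μ, false)))))))).map
        exp).prod := by
  letI : NormedAlgebra ℚ (Matrix (Fin 2) (Fin 2) ℂ) := NormedAlgebra.restrictScalars ℚ ℂ _
  -- notation
  set hh : ℕ := (P.L - 1) / 2 with hhh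
  have hL : P.L = 2 * hh + 1 := (two_mul_half_add_one P).symm
  set n : Fin P.d → ℤ := off r with hn
  have hnb : ∀ ν, -(hh : ℤ) ≤ n ν ∧ n ν ≤ (hh : ℤ) := fun ν => off_bounds r ν
  set y' := y.shift μ with hy'
  set F := curv V y with hF
  set F' := curv V y' with hF'
  set U : Matrix (Fin 2) (Fin 2) ℂ := ((V ⟨y, μ⟩ : Matrix.specialUnitaryGroup (Fin 2) ℂ) : Matrix (Fin 2) (Fin 2) ℂ) with hU
  set t₁ : ℕ := ((hh : ℤ) - n μ).toNat with ht₁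
  set t₂ : ℕ := (n μ + (hh : ℤ)).toNat with ht₂
  have ht₁' : (t₁ : ℤ) = hh - n μ := by rw [ht₁]; have := hnb μ; omega
  have ht₂' : (t₂ : ℤ) = n μ + hh := by rw [ht₂]; have := hnb μ; omega
  set f : Fin P.d → ℤ := Function.update n μ (hh : ℤ) with hf
  set g : Fin P.d → ℤ := Function.update n μ (-(hh : ℤ)) with hg
  set z : Fin P.d → ℤ := Function.update (0 : Fin P.d → ℤ) μ (hh : ℤ) with hz
  have hfb : ∀ ν, -(hh : ℤ) ≤ f ν ∧ f ν ≤ hh := fun ν => by rw [hf, Function.update_apply]; split_ifs <;> [omega; exact hnb ν]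
  have hgb : ∀ ν, -(hh : ℤ) ≤ g ν ∧ g ν ≤ hh := fun ν => by rw [hg, Function.update_apply]; split_ifs <;> [omega; exact hnb ν]
  have hzb : ∀ ν, -(hh : ℤ) ≤ z ν ∧ z ν ≤ hh := fun ν => by
    rw [hz, Function.update_apply]; split_ifs <;> [omega; (rw [Pi.zero_apply]; omega)]
  have h0b : ∀ ν, -(hh : ℤ) ≤ (0 : Fin P.d → ℤ) ν ∧ (0 : Fin P.d → ℤ) ν ≤ hh := fun ν => by simp only [Pi.zero_apply]; omega
  -- the word split
  have hword : loopWord P.L μ n σ σ' = stairWord σ n ++ (List.replicate t₁ (μ, true) ++ ((μ, true) ::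
      (List.replicate t₂ (μ, true) ++ (wordRev (stairWord σ' n) ++ (List.replicate hh (μ, false) ++ ((μ, false) ::
        List.replicate hh (μ, false))))))) := by
    have h1 : List.replicate P.L ((μ, true) : Letter P.d) = List.replicate t₁ (μ, true) ++ ((μ, true) :: List.replicate t₂ (μ, true)) := by
      rw [← replicate_split]; congr 1; omega
    have h2 : List.replicate P.L ((μ, false) : Letter P.d) = List.replicate hh (μ, false) ++ ((μ, false) :: List.replicate hh (μ, false)) := by
      rw [← replicate_split]; congr 1; omega
    rw [loopWord, h1, h2]; simp only [List.append_assoc, List.cons_append]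
  -- positions
  have pA : walkEnd (emb y) (stairWord σ n) = siteAt y n := by
    rw [emb_eq_siteAt_zero, walkEnd_siteAt]; congr 1; funext ν; simp [netDisp_stairWord]
  have pB₁ : walkEnd (siteAt y n) (List.replicate t₁ ((μ, true) : Letter P.d)) = siteAt y f := by
    rw [walkEnd_siteAt]; congr 1; funext ν
    rw [Pi.add_apply, T4ReflectionCone.netDisp_replicate, hf, Function.update_apply]
    by_cases h : ν = μ
    · subst h; simp only [if_true, mul_one]; omega
    · simp [h, Ne.symm h]
  have pX : (siteAt y f).shift μ = siteAt y' g := by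
    rw [siteAt_shift, hy', siteAt_blockShift]; congr 1; funext ν
    rw [Pi.add_apply, Pi.add_apply, Pi.single_apply, Pi.single_apply, hf, hg, Function.update_apply, Function.update_apply]
    by_cases h : ν = μ
    · subst h; simp only [if_true]; omega
    · simp [h]
  have pB₂ : walkEnd (siteAt y' g) (List.replicate t₂ ((μ, true) : Letter P.d)) = siteAt y' n := by
    rw [walkEnd_siteAt]; congr 1; funext ν
    rw [Pi.add_apply, T4ReflectionCone.netDisp_replicate, hg, Function.update_apply]
    by_cases h : ν = μ
    · subst h; simp only [if_true, mul_one]; omega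
    · simp [h, Ne.symm h]
  have pC : walkEnd (siteAt y' n) (wordRev (stairWord σ' n)) = siteAt y' 0 := by
    rw [walkEnd_siteAt]; congr 1; funext ν; simp [netDisp_wordRev, netDisp_stairWord]
  have pD₁ : walkEnd (siteAt y' 0) (List.replicate hh ((μ, false) : Letter P.d)) = siteAt y' (Function.update (0 : Fin P.d → ℤ) μ (-(hh : ℤ))) := by
    rw [walkEnd_siteAt]; congr 1; funext ν
    rw [Pi.add_apply, T4ReflectionCone.netDisp_replicate, Function.update_apply]
    by_cases h : ν = μ
    · subst h; simp
    · simp [h, Ne.symm h]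
  have pY : (siteAt y' (Function.update (0 : Fin P.d → ℤ) μ (-(hh : ℤ)))).unshift μ = siteAt y z := by
    rw [siteAt_unshift, hy', siteAt_blockShift]; congr 1; funext ν
    rw [Pi.add_apply, Pi.sub_apply, Pi.single_apply, Pi.single_apply, hz, Function.update_apply, Function.update_apply]
    by_cases h : ν = μ
    · subst h; simp only [if_true, Pi.zero_apply]; omega
    · simp [h]
  -- the segments
  have sA := coe_holAt_walk_siteAt hj V y (stairWord σ n) 0 (box_stairWord σ r)
  rw [← emb_eq_siteAt_zero] at sA
  have sB₁ := coe_holAt_walk_siteAt hj V y (List.replicate t₁ (μ, true)) n (box_replicate_true hnb μ (by rw [ht₁']; omega))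
  have sX := coe_interp_face hj V y μ hfb (by rw [hf, Function.update_self])
  have sB₂ := coe_holAt_walk_siteAt hj V y' (List.replicate t₂ (μ, true)) g
    (box_replicate_true hgb μ (by rw [ht₂', hg, Function.update_self]; omega))
  have sC := coe_holAt_walk_siteAt hj V y' (wordRev (stairWord σ' n)) n (box_wordRev_stairWord σ' r)
  have sD₁ := coe_holAt_walk_siteAt hj V y' (List.replicate hh (μ, false)) 0
    (box_replicate_false h0b μ (by rw [Pi.zero_apply]; omega))
  have sY := coe_interp_central hj V y μ
  have sD₂ := coe_holAt_walk_siteAt hj V y (List.replicate hh (μ, false)) z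
    (box_replicate_false hzb μ (by rw [hz, Function.update_self]; omega))
  -- assemble the walk
  unfold loopHol
  rw [hword, walk_append, holAt_append, pA, walk_append, holAt_append, pB₁]
  rw [walk, holAt_cons, pX, walk_append, holAt_append, pB₂, walk_append, holAt_append, pC, walk_append, holAt_append, pD₁]
  rw [walk, holAt_cons, pY]
  simp only [if_true, Bool.false_eq_true, if_false, Submonoid.coe_mul, coe_inv_su2]
  rw [sA, sB₁, sX, sB₂, sC, sD₁, sY, sD₂]
  -- conjugate the three segments in `B(y + e_μ)` by `V(c)`
  rw [stepExps_conj P (curv V y') U (List.replicate t₂ (μ, true)), stepExps_conj P (curv V y') U (wordRev (stairWord σ' n)),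
    stepExps_conj P (curv V y') U (List.replicate hh (μ, false))]
  have k := congrArg (· * ((stepExps P (curv V y) z (List.replicate hh (μ, false))).map exp).prod)
    (conj_prod_map_exp (V ⟨y, μ⟩) (stepExps P (curv V y') g (List.replicate t₂ (μ, true)) ++
      (stepExps P (curv V y') n (wordRev (stairWord σ' n)) ++ stepExps P (curv V y') 0 (List.replicate hh (μ, false)))))
  simp only [List.map_append, List.prod_append, List.map_cons, List.map_nil, List.prod_cons, List.prod_nil, mul_one, mul_assoc] at k ⊢
  rw [k]

end Product


end Summit.QuantumFields.YangMills.Theorems.SmoothLiftInterp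

end
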